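import Summits.Schanuel.Schanuel.Theorems.SoloInformedGenericStructuredRoots
import Summits.Schanuel.Schanuel.Theorems.SoloInformedLemmaAE3
import Summits.Schanuel.Schanuel.Theorems.SoloInformedAPRigidity

/-!
# Generic structured roots, 3-AP version: an auxiliary pair `(Q, R)` small on most of a progression

Soloist file (informed mode, seat `solo-Schanuel-informed`, s182).  The 3-term-progression
version of `SoloInformedGenericStructuredRoots` (LEMMA AE₃ + THEOREM C₃ in place of Lemma AE +
Theorem C), i.e. the generic form of `soloS3_structured_roots` needed by the conditional members
of the seat's AE₃ line (`paper/AE-note.md` §14; THEOREM AE₃-1τ): `Q` is the primitive gcd of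
divided derivatives of Roy's polynomial — small at most points `cξ`, `1 ≤ c ≤ K`, by D. Roy's
pointwise transfer [cite: Roy2010, Cor 3.2] — and `R` is its radical ([cite: Roy2010, §1 p. 4,
step (3)]), of degree `≤ D₀` and Mahler measure `≤ exp L₀`, vanishing at every root of `Q`.

`soloG3S_structured_roots`: let `Q, R ∈ ℤ[X]` be non-zero, `deg Q ≤ n`, every complex root of
`Q` a root of `R`, `deg R ≤ D₀`, `log M(R) ≤ L₀`; let `E ⊆ ℕ` with `80000·#E ≤ K` (`K ≥ 2000`)
and `|Q(cξ)| ≤ exp(-V)` for `c ∈ [1, K] ∖ E`; put `W = V K / (160000 n)`, `ε = exp(-W)` and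
assume `exp(-c₁) ≤ min(1, ‖ξ‖/2)`, `2 c₁ n ≤ V`, `log 4 ≤ W/2` and the budget inequality
`400000 (3 D₀² L₀ + 2 D₀³) ≤ K² · W`.  Then there are `S' ⊆ [1, K]` with `#S' ≥ (49/100) K`
and `γ, μ ∈ ℂ`, `μ ≠ 0`, with `R(γ + sμ) = 0` and `‖γ + sμ - sξ‖ ≤ ε` for all `s ∈ S'`.

Chain: `soloSS_servedSet_int` for `Q` on `[1, K] ∖ E` (serving parameter `80000 n / K`, so
that at most `K/40000` points of `[1, K]` are unserved or bad) → re-indexing of the served roots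
of `Q` as roots of `R` → `soloAP_lemmaAE3` for `R` (budget `soloG3S_budget_le`:
`#V₃ · W/2 ≤ 3 D₀² L₀ + 2 D₀³`) → THEOREM C₃ `soloAR_even_affine_of_few_violated_progressions`
(`≥ 0.49 K` even points on one progression) → `μ ≠ 0` by the served-distance argument.

What this is NOT.  No small value estimate is proved here and nothing bears on
`Literature.Periods.SchanuelConjecture` (the seat's verdict, no path, is unchanged); the node
[cite: Roy2010, Thm 1.1] is not claimed.  Tree files and Mathlib only; no definitions, no
literature hypothesis; axioms the standard three.
-/

namespace Summit.Schanuel.Schanuel.Theorems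

open Polynomial Finset

/-- The right side of Lemma AE₃ for `deg R = D ≤ D₀` and `0 ≤ L ≤ L₀`:
`3D² · L + D³ · log 4 ≤ 3 D₀² L₀ + 2 D₀³`. -/
theorem soloG3S_budget_le {D : ℕ} {D₀ L₀ L : ℝ} (hD : (D : ℝ) ≤ D₀) (hL0 : 0 ≤ L)
    (hL : L ≤ L₀) :
    ((3 * D ^ 2 : ℕ) : ℝ) * L + ((D ^ 3 : ℕ) : ℝ) * Real.log 4 ≤
      3 * D₀ ^ 2 * L₀ + 2 * D₀ ^ 3 := by
  have hDr : (0 : ℝ) ≤ D := Nat.cast_nonneg D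
  have hD₀ : 0 ≤ D₀ := hDr.trans hD
  have h1 : ((3 * D ^ 2 : ℕ) : ℝ) ≤ 3 * D₀ ^ 2 := by
    push_cast; gcongr
  have h2 : ((D ^ 3 : ℕ) : ℝ) ≤ D₀ ^ 3 := by
    push_cast; gcongr
  have hlog4 : Real.log 4 ≤ 2 := by
    have h : Real.log 4 = 2 * Real.log 2 := by
      rw [show (4 : ℝ) = 2 ^ 2 by norm_num, Real.log_pow]; norm_num
    have := Real.log_two_lt_d9; norm_num at this; rw [h]; linarith
  have hlog0 : 0 ≤ Real.log 4 := Real.log_nonneg (by norm_num)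
  calc ((3 * D ^ 2 : ℕ) : ℝ) * L + ((D ^ 3 : ℕ) : ℝ) * Real.log 4
      ≤ 3 * D₀ ^ 2 * L₀ + D₀ ^ 3 * 2 :=
        add_le_add (mul_le_mul h1 hL hL0 (by positivity))
          (mul_le_mul h2 hlog4 hlog0 (by positivity))
    _ = 3 * D₀ ^ 2 * L₀ + 2 * D₀ ^ 3 := by ring

/-- **Generic structured roots, 3-AP version (AE-note §14 for an auxiliary pair `(Q, R)`).**
See the module docstring for the statement in words; `W = V K / (160000 n)`. -/
theorem soloG3S_structured_roots {ξ : ℂ} {n K : ℕ} (hn : 1 ≤ n) (hK : 2000 ≤ K) {Q R : ℤ[X]}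
    (hQ0 : Q ≠ 0) (hQdeg : Q.natDegree ≤ n) (hR0 : R ≠ 0)
    (hQR : ∀ z : ℂ, aeval z Q = 0 → aeval z R = 0) {D₀ L₀ : ℝ} (hD : (R.natDegree : ℝ) ≤ D₀)
    (hL : Real.log (R.map (Int.castRingHom ℂ)).mahlerMeasure ≤ L₀) (E : Finset ℕ)
    (hE : 80000 * #E ≤ K) {c₁ V : ℝ} (hc : Real.exp (-c₁) ≤ min 1 (‖ξ‖ / 2))
    (h₁ : 2 * c₁ * n ≤ V)
    (hsmall : ∀ c ∈ Icc 1 K \ E, ‖aeval ((c : ℂ) * ξ) Q‖ ≤ Real.exp (-V))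
    (h₄ : Real.log 4 ≤ V * K / (320000 * n))
    (h₅ : 400000 * (3 * D₀ ^ 2 * L₀ + 2 * D₀ ^ 3) ≤ (K : ℝ) ^ 2 * (V * K / (160000 * n))) :
    ∃ S' : Finset ℕ, S' ⊆ Icc 1 K ∧ (49 : ℝ) / 100 * K ≤ #S' ∧ ∃ γ μ : ℂ, μ ≠ 0 ∧
      ∀ s ∈ S', aeval (γ + (s : ℂ) * μ) R = 0 ∧
        ‖(γ + (s : ℂ) * μ) - (s : ℂ) * ξ‖ ≤ Real.exp (-(V * K / (160000 * n))) := by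
  classical
  obtain ⟨ρ, hρ⟩ := soloSI_exists_roots_enum (L := ℂ) Q
  obtain ⟨ρR, hρR⟩ := soloSI_exists_roots_enum (L := ℂ) R
  have hn0 : (0 : ℝ) < n := by exact_mod_cast hn
  have hK0 : (0 : ℝ) < K := by exact_mod_cast (show 0 < K by omega)
  set W : ℝ := V * K / (160000 * n) with hW
  have hW2 : V * K / (320000 * n) = W / 2 := by rw [hW]; ring
  rw [hW2] at h₄
  set ε : ℝ := Real.exp (-W) with hε
  have hε0 : 0 < ε := Real.exp_pos _
  have hlog4pos : 0 < Real.log 4 := Real.log_pos (by norm_num)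
  have hW0 : 0 < W := by linarith
  have hV0 : 0 < V := by
    have h : W * (160000 * n) = V * K := by rw [hW]; field_simp
    by_contra hV
    have h1 : V * K ≤ 0 := mul_nonpos_of_nonpos_of_nonneg (not_lt.mp hV) hK0.le
    nlinarith [mul_pos hW0 (by positivity : (0 : ℝ) < 160000 * n)]
  have hR' : R.map (Int.castRingHom ℂ) ≠ 0 :=
    (Polynomial.map_ne_zero_iff Int.cast_injective).mpr hR0
  -- Step 0: `Q` has positive degree (it is small at some point of the progression)
  have hCne : (Icc 1 K \ E).Nonempty := by
    rw [← Finset.card_pos]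
    have h1 : #(Icc 1 K) - #E ≤ #(Icc 1 K \ E) := Finset.le_card_sdiff E (Icc 1 K)
    rw [Nat.card_Icc] at h1
    omega
  have hDQ : 0 < Q.natDegree := by
    obtain ⟨c, hc'⟩ := hCne
    by_contra h
    have h0 : Q.natDegree = 0 := by omega
    have hv := hsmall c hc'
    rw [eq_C_of_natDegree_eq_zero h0, aeval_C, algebraMap_int_eq, eq_intCast,
      Complex.norm_intCast] at hv
    have hc0 : Q.coeff 0 ≠ 0 := by
      intro hq
      apply hQ0
      rw [eq_C_of_natDegree_eq_zero h0, hq, C_0]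
    have h1' : (1 : ℝ) ≤ |((Q.coeff 0 : ℤ) : ℝ)| := by exact_mod_cast Int.one_le_abs hc0
    have h2' : Real.exp (-V) < 1 := Real.exp_lt_one_iff.mpr (by linarith)
    linarith
  -- Step 1: the served set for `Q` on `[1, K] ∖ E`, serving parameter `80000 n / K`
  have hc₁0 : 0 ≤ c₁ := by
    have h := (le_min_iff.mp hc).1
    have := Real.exp_le_one_iff.mp h
    linarith
  have hVc : c₁ * n < V := by
    rcases (mul_nonneg hc₁0 hn0.le).eq_or_lt with h | h
    · rw [← h]; exact hV0
    · linarith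
  have hsmall' : ∀ c ∈ Icc 1 K \ E,
      ‖(Q.map (Int.castRingHom ℂ)).eval ((c : ℂ) * ξ + 0)‖ ≤ Real.exp (-V) := by
    intro c hc'
    rw [add_zero, eval_map_intCastRingHom]
    exact hsmall c hc'
  obtain ⟨S, hSC, ιQ, hcardt, -, hnear, hfar⟩ :=
    soloSS_servedSet_int (N := n) Q hQ0 ρ hρ hDQ hQdeg ξ 0 (Icc 1 K \ E) (80000 * n / K) hc hVc
      hsmall'
  have hrad : Real.exp (-(V - c₁ * n) / (80000 * n / K)) ≤ ε := by
    rw [hε, Real.exp_le_exp, neg_div, neg_le_neg_iff, le_div_iff₀ (by positivity)]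
    have : W * (80000 * n / K) = V / 2 := by
      rw [hW]; field_simp; ring
    rw [this]
    linarith
  -- re-index the served roots of `Q` as roots of `R`
  have hex : ∀ c : ℕ, ∃ k : Fin R.natDegree, ρR k = ρ (ιQ c) := by
    intro c
    have hz : aeval (ρ (ιQ c)) R = 0 := hQR _ (soloSR_aeval_enum_eq_zero Q hQ0 ρ hρ (ιQ c))
    have hmem : ρ (ιQ c) ∈ (R.map (Int.castRingHom ℂ)).roots := by
      rw [mem_roots hR', IsRoot.def, eval_map_intCastRingHom]
      exact hz
    rw [← hρR, Multiset.mem_map] at hmem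
    obtain ⟨k, -, hk⟩ := hmem
    exact ⟨k, hk⟩
  choose ι hι using hex
  have hnear' : ∀ s ∈ S, ‖ρR (ι s) - (s : ℂ) * ξ‖ < ‖ξ‖ / 2 := by
    intro s hs
    have h := hnear s hs
    rwa [add_zero, ← hι s] at h
  have hιS : Set.InjOn ι S := by
    intro a ha b hb hab
    have h1 := hnear' a ha
    have h2 := hnear' b hb
    rw [hab] at h1
    exact soloGS_eq_of_near h1 h2
  have hservedε : ∀ s ∈ S, ‖ρR (ι s) - (s * ξ + 0)‖ ≤ ε := by
    intro s hs
    rw [hι s]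
    exact (hfar s hs).trans hrad
  have hSI : S ⊆ Icc 1 K := fun s hs => (Finset.mem_sdiff.mp (hSC hs)).1
  have hE' : 40000 * #(Icc 1 K \ S) ≤ K := by
    have h : (#((Icc 1 K \ E) \ S) : ℝ) * (80000 * n / K) ≤ n := hcardt
    rw [← mul_div_assoc, div_le_iff₀ hK0] at h
    have h3 : (80000 * (#((Icc 1 K \ E) \ S) : ℝ)) * n ≤ K * n := by linarith
    have h4 := le_of_mul_le_mul_right h3 hn0
    have h5 : 80000 * #((Icc 1 K \ E) \ S) ≤ K := by exact_mod_cast h4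
    have h6 : Icc 1 K \ S ⊆ E ∪ ((Icc 1 K \ E) \ S) := by
      intro x hx
      rw [Finset.mem_union, Finset.mem_sdiff, Finset.mem_sdiff]
      rw [Finset.mem_sdiff] at hx
      by_cases hxE : x ∈ E
      · exact Or.inl hxE
      · exact Or.inr ⟨⟨hx.1, hxE⟩, hx.2⟩
    have h7 := (Finset.card_le_card h6).trans (Finset.card_union_le _ _)
    omega
  -- Step 2: the violated 3-term progressions are inexact progressions of roots of `R`
  set V₃ : Finset (ℕ × ℕ × ℕ) := (S ×ˢ (S ×ˢ S)).filter
    (fun c => c.1 + c.2.2 = 2 * c.2.1 ∧ ρR (ι c.1) + ρR (ι c.2.2) ≠ 2 * ρR (ι c.2.1))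
    with hV₃
  have hVmem : ∀ x ∈ S, ∀ m ∈ S, ∀ z ∈ S, x + z = 2 * m →
      (fun s => ρR (ι s)) x + (fun s => ρR (ι s)) z ≠ 2 • (fun s => ρR (ι s)) m →
        (x, m, z) ∈ V₃ := by
    intro x hx m hm z hz hxz hne
    rw [hV₃, Finset.mem_filter, Finset.mem_product, Finset.mem_product]
    refine ⟨⟨hx, hm, hz⟩, hxz, ?_⟩
    intro h
    apply hne
    simp only [nsmul_eq_mul, Nat.cast_ofNat]
    exact h
  have hV₃mem : ∀ c ∈ V₃, (c.1 ∈ S ∧ c.2.1 ∈ S ∧ c.2.2 ∈ S) ∧ c.1 + c.2.2 = 2 * c.2.1 ∧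
      ρR (ι c.1) + ρR (ι c.2.2) ≠ 2 * ρR (ι c.2.1) := by
    intro c hc
    rw [hV₃, Finset.mem_filter, Finset.mem_product, Finset.mem_product] at hc
    exact hc
  have hAE := soloAP_lemmaAE3 R hR0 rfl ρR hρR ξ 0 hε0 S ι hιS hservedε V₃
    (fun c hc => (hV₃mem c hc).1) (fun c hc => (hV₃mem c hc).2.1)
    (fun c hc => (hV₃mem c hc).2.2)
  -- the numerical budget: `#V₃ · W/2 ≤ 3 D₀² L₀ + 2 D₀³`
  have hL' : W / 2 ≤ Real.log (1 / (4 * ε)) := by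
    rw [one_div, Real.log_inv, hε, Real.log_mul (by norm_num) (Real.exp_pos _).ne',
      Real.log_exp]
    linarith
  have hlogM0 : 0 ≤ Real.log (R.map (Int.castRingHom ℂ)).mahlerMeasure :=
    Real.log_nonneg (Polynomial.one_le_mahlerMeasure_of_ne_zero hR0)
  have hB := soloG3S_budget_le hD hlogM0 hL
  have hD₀ : 0 ≤ D₀ := (Nat.cast_nonneg _).trans hD
  have hL₀ : 0 ≤ L₀ := hlogM0.trans hL
  have hB0 : 0 ≤ 3 * D₀ ^ 2 * L₀ + 2 * D₀ ^ 3 := by positivity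
  have hVcard : (#V₃ : ℝ) * (W / 2) ≤ 3 * D₀ ^ 2 * L₀ + 2 * D₀ ^ 3 := by
    calc (#V₃ : ℝ) * (W / 2) ≤ #V₃ * Real.log (1 / (4 * ε)) :=
          mul_le_mul_of_nonneg_left hL' (Nat.cast_nonneg _)
      _ ≤ _ := hAE
      _ ≤ 3 * D₀ ^ 2 * L₀ + 2 * D₀ ^ 3 := hB
  have hVK : 200000 * #V₃ ≤ K ^ 2 := by
    have key : (200000 * #V₃ : ℝ) * (W / 2) ≤ (K : ℝ) ^ 2 * (W / 2) := by
      calc (200000 * #V₃ : ℝ) * (W / 2) = 200000 * ((#V₃ : ℝ) * (W / 2)) := by ring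
        _ ≤ 200000 * (3 * D₀ ^ 2 * L₀ + 2 * D₀ ^ 3) :=
            mul_le_mul_of_nonneg_left hVcard (by norm_num)
        _ ≤ (K : ℝ) ^ 2 * (W / 2) := by linarith
    have h := le_of_mul_le_mul_right key (half_pos hW0)
    exact_mod_cast h
  -- Step 3: THEOREM C₃ (even part)
  obtain ⟨γ, μ, Y, hYcard, hY⟩ :=
    soloAR_even_affine_of_few_violated_progressions hK hE' (fun s => ρR (ι s)) hVmem hVK
  have hY' : ∀ y ∈ Y, 2 * y ∈ S ∧ ρR (ι (2 * y)) = γ + ((2 * y : ℕ) : ℂ) * (μ / 2) := by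
    intro y hy
    obtain ⟨hyS, h⟩ := hY y hy
    refine ⟨hyS, ?_⟩
    have h' : ρR (ι (2 * y)) = γ + (y : ℂ) * μ := by
      have h'' := h
      simp only [nsmul_eq_mul] at h''
      exact h''
    rw [h']
    push_cast
    ring
  -- Step 4: the structured set `S' = 2 • Y`
  set S' := Y.image (fun y => 2 * y) with hS'
  have hS'sub : S' ⊆ Icc 1 K := by
    intro s hs
    obtain ⟨y, hy, rfl⟩ := Finset.mem_image.mp hs
    exact hSI (hY' y hy).1
  have hS'card' : #S' = #Y :=
    Finset.card_image_of_injective _ (fun a b h => by simpa using h)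
  have hS'card : (49 : ℝ) / 100 * K ≤ #S' := by
    rw [hS'card']
    have h : ((49 * K : ℕ) : ℝ) ≤ ((100 * #Y : ℕ) : ℝ) := by exact_mod_cast hYcard
    push_cast at h
    linarith
  have hS'aff : ∀ s ∈ S', s ∈ S ∧ ρR (ι s) = γ + (s : ℂ) * (μ / 2) := by
    intro s hs
    obtain ⟨y, hy, rfl⟩ := Finset.mem_image.mp hs
    exact hY' y hy
  have hμ : μ / 2 ≠ 0 := by
    intro hμ
    have hK' : (2000 : ℝ) ≤ K := by exact_mod_cast hK
    have h980 : (980 : ℝ) ≤ #S' := by linarith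
    have hcard' : 1 < #S' := by
      have : (980 : ℕ) ≤ #S' := by exact_mod_cast h980
      omega
    obtain ⟨a, ha, b, hb, hab⟩ := Finset.one_lt_card.mp hcard'
    obtain ⟨haS, hφa⟩ := hS'aff a ha
    obtain ⟨hbS, hφb⟩ := hS'aff b hb
    rw [hμ, mul_zero, add_zero] at hφa hφb
    have h1 := hnear' a haS
    have h2 := hnear' b hbS
    rw [hφa] at h1
    rw [hφb] at h2
    exact hab (soloGS_eq_of_near h1 h2)
  refine ⟨S', hS'sub, hS'card, γ, μ / 2, hμ, ?_⟩
  intro s hs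
  obtain ⟨hsS, hφs⟩ := hS'aff s hs
  refine ⟨?_, ?_⟩
  · rw [← hφs]; exact soloSR_aeval_enum_eq_zero R hR0 ρR hρR (ι s)
  · rw [← hφs]
    have h := hservedε s hsS
    rwa [add_zero] at h

end Summit.Schanuel.Schanuel.Theorems
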